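import Summits.QuantumFields.YangMills.Theorems.UnitScaleTiltProp7CombTowerCentral
import Summits.QuantumFields.YangMills.Theorems.UnitScaleTiltProp7SymAvgTwSymDefs
import Summits.QuantumFields.YangMills.Theorems.UnitScaleTiltProp7SymAvgTwDefs
import HarnessLib

/-!
# Route `UnitScaleTilt`, crux K1 child «MinimiserStabilityRegPr» (stmt-QuantumFields-19200), stub `stub_existenceMinimalOrbit` (EX), lane II (B4★)∕(QB) «⊕ central» summand —
# **THE COMB CHART `QTw` ON THE CENTRE `ℂ·1` IS ITS FLAT VALUE** (T³ letters; the comb-chart twin of ✓`Prop7QTwSScalarSector`): for a CENTRAL perturbation `A = (iz)·1` the comb frames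
# `frameTw U₀ A y = \overline{R_{0,y}e^{A}}^{(k)}` are the embedded flat accumulated frames of the scalar field `e^{iz}` (✓`Prop7CombTowerCentral.wrec_centralMul_self`: they do not see the
# background), the symmetric descent of `e^{A}U₀` is `ι(Ū^{(k)}(e^{iz}))·Ū₀^{(k)}` (the plain torus tower of a central multiple, §1), so the twisted double-bar variable
# `dbarTw U₀ A c = w(c₋)⁻¹·D̄(e^{A}U₀)(c)·w(c₊)·D̄(U₀)(c)⁻¹` collapses to the central unit `ι(v(ĉ₋)⁻¹·Ū^{(k)}(e^{iz})(ĉ)·v(ĉ₊))` — ITS VALUE AT `U₀ = 1` — on the nose; hence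
# `log U̿^{tw}_{U₀}((iz)·1) = log U̿^{tw}_{1}((iz)·1)` near `z = 0` and, differentiating along the real line `t ↦ (t·ir)·1`, **`QTw U₀ ((ir)·1) = QTw 1 ((ir)·1)`** for every real bond field
# `r`, whence for EVERY complex scalar field by ℂ-linearity (§4).

Cell `ym3-torus`, width seat `ym3-torus-px10` (gen 5).  `--supports stmt-QuantumFields-19200 --as helper`; THEOREMS ONLY (0 `def`, 0 `sorry`); count-neutral; nothing here claims the
stub, the crux, d = 4 or the mass gap — YM₃ on T³ is a ladder rung (R3), not the Clay problem.

WHY (px19 g6 LOCATE v2 §3 exit (c-i); px10 g5 LOCATE `LOCATE-QBc-CENTRAL-COMB-px10g5.md`).  Lane II's engine (ENG)∕(QB) (✓`Prop7HcoOfDivRecovery.hCo_of_divRecovery`'s `hEng`) is stated on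
ALL `M₂(ℂ)`-valued one-forms and decouples across traceless ⊕ central; the traceless summand is px19's leg identity ⊕ (R-LEGS); the central summand reads `QTw U₀` on `ℂ·1`, for which the
tree had the SYMMETRIC-chart calculus only (✓`QTwS_apply_smul_one[_of_regPr]`, ✓`QTwS_smul_one_eq_QTwS_one_of_regPr`).  With §4 the central sector of (ENG) IS the flat comb Poincaré
inequality (✓`Prop7QTwFlatExplicitT3.QTw_one_apply`∕`QTw_one_eq_tube_sub_coarseGrad`).  The smallness clauses are DISPLAYED here (loop variables of the background towers on `ℤ³` and on
the torus, of the scalar towers, and the scalar frame quotients); the sibling `…Prop7QTwCentralSectorRegPr` discharges them at a printed-regular background for small real `t`.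

WHAT IS PROVED (`k := K − n`, `x₀ := basePt F n K`, `U₀♯ := pull (bgUnits F K U₀) x₀`, `φ := (b ↦ e^{iz(b)})`, `φ♯ := pull φ x₀`, `ĉ := bondShift (sites_eq F n K h) c`, `ιˣ := Units.map (algebraMap ℂ M₂)`):
* §1 (generic torus `Params`, any complete normed ℂ-algebra) ★`emlIterU_centralMul` — the PLAIN `exp[mean log]` tower of `(ιφ)·W` is `ι(Ūᵏ(φ))·W̄ᵏ` (induction over ✓`Prop7SymAvgTwSym.emlAvgU_centralMul`,
  windows: loop variables of `W̄ʲ`, `φ̄ʲ`, `j < k`, within `1∕8`).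
* §2 (T³) `expUnit_smul_one_eq`, `pull_unitsMap`, `pull_bgUnits_one`; ★`frameTw_central` (`frameTw U₀ ((iz)·1) y = ιˣ(wrec L 1 φ♯ k (coordT3 y))`); ★★`dbarTw_central`
  (`dbarTw U₀ ((iz)·1) c = ιˣ(wrec L 1 φ♯ k (coordT3 c₋)⁻¹ · Ūᵏ(φ)(ĉ) · wrec L 1 φ♯ k (coordT3 c₊))`), `dbarTw_central_one` (the same at `U₀ = 1`, no background clause),
  ★★`dbarTw_central_eq_dbarTw_one`, ★★`logChartTw_central_eq_logChartTw_one`.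
* §3 (calculus) ★`QTw_apply_eq_of_eventuallyEq_line` — two twisted log-charts differentiable at `0` that agree along the real line `t ↦ (t:ℂ)•V` near `t = 0` have the same `Q(·)V`.
* §4 ★★★`QTw_smulI_one_eq_QTw_one` (`QTw U₀ ((i r)·1) = QTw 1 ((i r)·1)` for REAL `r`, under `hd`, `hd₁` and the displayed `∃ δ` clause) and ★★★`QTw_smul_one_eq_QTw_one_of_imaginary`
  (ℂ-linearity: the identity for every `(i r)·1`, `r` real, gives it for every `c·1`, `c` complex).
HONEST SCOPE.  Bookkeeping over ✓`Prop7CombTowerCentral`, ✓`Prop7EMLTowerCentral` and the chart definitions; every smallness clause DISPLAYED; nothing of [Balaban1985Averaging]∕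
[Balaban1985BackgroundPropagators] is asserted; (ENG)∕(QB)∕(REC)∕`hN06` are NOT advanced by this file alone.

References: T. Bałaban, CMP **98** (1985) 17–51 [Balaban1985Averaging] ((82) p.30, (85)+(87) p.31, (89)–(92) p.31, (97)+(99) p.32, (160) p.42); CMP **99** (1985) 389–434
[Balaban1985BackgroundPropagators] ((3.13)–(3.15) p.393); CMP **95** (1984) 17–40 [Balaban1984PropagatorsI] ((1.18) p.20); CMP **102** (1985) 277–309 [Balaban1985Variational] ((44) p.285);
CMP **109** (1987) 249–301 [Balaban1987RG1] ((0.4), (0.6), (0.11) p.253).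
-/

set_option autoImplicit false

noncomputable section

open scoped Matrix.Norms.L2Operator Topology

namespace Summit.QuantumFields.YangMills.Theorems.Prop7QTwCentralSector

open NormedSpace Filter
open Literature.MathematicalPhysics.QuantumFieldTheory.Balaban1983to89
open T4Continuum BlockAveraging ExpMeanLog MatrixLog
open T3ContinuumYM3Torus
open T3LevelShift (siteShift bondShift)
open T3PrintedRegularOrbits (sites_eq)
open T3SectALandauChart (bgUnits bgUnits_one)
open B7Prop1Explicit renaming Site → LSite
open B7Prop1Explicit (expUnit val_expUnit boxVec treeWord hol Wcx)
open B7Prop2Explicit (avgIter)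
open B7Eq92Concrete (avgIter_one)
open B7Eq99Concrete (wrec)
open B8Ineq130 (Wcx_one)
open B10Eq27TorusAxialLog (holT holT_one pull pull_apply)
open Summit.QuantumFields.YangMills.Theorems.Prop7SPrint (basePt)
open Summit.QuantumFields.YangMills.Theorems.Prop8Chart (loopHolU emlAvgU emlIterU emlIterU_succ emlIterU_zero emlIterU_one)
open Summit.QuantumFields.YangMills.Theorems.Prop7SymAvgGL (descendToGL)
open Summit.QuantumFields.YangMills.Theorems.Prop7SymAvgTw (coordT3 frameTw dbarTw logChartTw QTw frameTw_def dbarTw_def logChartTw_apply QTw_def)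
open Summit.QuantumFields.YangMills.Theorems.Prop7SymAvgTwSym (descendToGL_apply_eq_emlIterU expUnit_smul_one_mul emlAvgU_centralMul loopHolU_centralMul commute_unitsMap_algebraMap)
open Summit.QuantumFields.YangMills.Theorems.Prop7CombTowerCentral (wrec_centralMul_self unitsMap_expUnit)

/-! ## §1 The plain `exp[mean log]` tower of a centrally rescaled torus field -/

section Torus

variable {𝔸 : Type*} [NormedRing 𝔸] [NormOneClass 𝔸] [NormedAlgebra ℂ 𝔸] [CompleteSpace 𝔸]
variable {P : Params}

/-- ★ **THE PLAIN TOWER OF `(ιφ)·W` FACTORS**: `emlIterU k ((ιφ)·W) = (ι ∘ emlIterU k φ)·emlIterU k W`, PROVIDED at every level `j < k` the (0.4) loop variables of the iterates `W̄ʲ` and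
`φ̄ʲ` are within `1∕8` of `1` (induction over ✓`emlAvgU_centralMul`; the plain-tower twin of ✓`dbarCovIterU_centralMul_self`). [cite: Balaban1987RG1, (0.4) p.253, (0.6) p.253, (0.11) p.253] -/
theorem emlIterU_centralMul (φ : GaugeField P 0 ℂˣ) (W : GaugeField P 0 𝔸ˣ) :
    ∀ k : ℕ,
      (∀ j, j < k → ∀ (c : PBond P (j + 1)) (i : Idx P), ‖((loopHolU (emlIterU j W) c i : 𝔸ˣ) : 𝔸) - 1‖ ≤ 1 / 8) →
      (∀ j, j < k → ∀ (c : PBond P (j + 1)) (i : Idx P), ‖((loopHolU (emlIterU j φ) c i : ℂˣ) : ℂ) - 1‖ ≤ 1 / 8) →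
      emlIterU k (fun b => Units.map ((algebraMap ℂ 𝔸 : ℂ →+* 𝔸) : ℂ →* 𝔸) (φ b) * W b) =
        fun e => Units.map ((algebraMap ℂ 𝔸 : ℂ →+* 𝔸) : ℂ →* 𝔸) (emlIterU k φ e) * emlIterU k W e
  | 0 => fun _ _ => by funext e; rw [emlIterU_zero, emlIterU_zero, emlIterU_zero]
  | k + 1 => fun hW hφ => by
    have ih := emlIterU_centralMul φ W k (fun j hj => hW j (by omega)) (fun j hj => hφ j (by omega))
    funext e
    rw [emlIterU_succ, ih, emlAvgU_centralMul (emlIterU k φ) (emlIterU k W) e (hW k (by omega) e) (hφ k (by omega) e), emlIterU_succ, emlIterU_succ]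

omit [NormOneClass 𝔸] [NormedAlgebra ℂ 𝔸] [CompleteSpace 𝔸] in
/-- the loop variables of the flat field are `1`. [cite: Balaban1987RG1, (0.4) p.253] -/
theorem loopHolU_const_one {j : ℕ} (c : PBond P (j + 1)) (i : Idx P) : loopHolU (fun _ : PBond P j => (1 : 𝔸ˣ)) c i = 1 := by
  unfold loopHolU
  exact holT_one _ _

end Torus

/-! ## §2 The comb frames and the twisted double-bar variable of a central perturbation (T³ letters) -/

section T3

variable (F : T3Family) {n K : ℕ} (h : n ≤ K)

/-- the central perturbation `e^{(iz)·1}` in units is the embedded scalar exponential: `(b ↦ e^{(iz(b))·1}) = (b ↦ ιˣ e^{iz(b)})`. [cite: Balaban1985Variational, (44) p.285; Balaban1985Averaging, (21) p.22] -/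
theorem expUnit_smul_one_eq (z : PBond (F.P K) 0 → ℂ) :
    (fun b => expUnit ((Complex.I * z b) • (1 : Matrix (Fin 2) (Fin 2) ℂ))) =
      fun b => Units.map ((algebraMap ℂ (Matrix (Fin 2) (Fin 2) ℂ) : ℂ →+* Matrix (Fin 2) (Fin 2) ℂ) : ℂ →* Matrix (Fin 2) (Fin 2) ℂ) (expUnit (Complex.I * z b)) := by
  funext b
  rw [unitsMap_expUnit, Algebra.algebraMap_eq_smul_one]

/-- the based pullback of an embedded scalar field is the embedded pullback (`rfl`). [cite: Balaban1985RegularSpaces, (1.3) p.77] -/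
theorem pull_unitsMap {G H : Type*} [Group G] [Group H] {j : ℕ} (f : G →* H) (φ : GaugeField (F.P K) j G) (x₀ : Site (F.P K) j) :
    pull (fun b => f (φ b)) x₀ = fun w κ => f (pull φ x₀ w κ) := rfl

/-- the based pullback of the flat background is flat. [cite: Balaban1985RegularSpaces, (1.3) p.77] -/
theorem pull_bgUnits_one (x₀ : Site (F.P K) 0) :
    pull (bgUnits F K (1 : GaugeField (F.P K) 0 (Matrix.specialUnitaryGroup (Fin 2) ℂ))) x₀ = (1 : LSite (F.P K).d → Fin (F.P K).d → (Matrix (Fin 2) (Fin 2) ℂ)ˣ) := by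
  rw [bgUnits_one]; rfl

/-- ★ **THE COMB FRAME OF A CENTRAL PERTURBATION IS THE EMBEDDED FLAT SCALAR FRAME**: `frameTw U₀ ((iz)·1) y = ιˣ(wrec L 1 φ♯ (K−n) (coordT3 y))`, `φ♯ = (e^{iz})♯` — it does NOT see `U₀`
(✓`Prop7CombTowerCentral.wrec_centralMul_self`; windows displayed: loop variables of `Ū₀♯ʲ`, `φ̄♯ʲ`, `j < K − n`, within `1∕8`; flat scalar frame quotients within `1`).
[cite: Balaban1985Averaging, (85) p.31, (87) p.31, (97)+(99) p.32, (160) p.42] -/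
theorem frameTw_central (U₀ : GaugeField (F.P K) 0 (Matrix.specialUnitaryGroup (Fin 2) ℂ)) (z : PBond (F.P K) 0 → ℂ)
    (hUZ : ∀ j, j < K - n → ∀ (q : LSite (F.P K).d) (κ : Fin (F.P K).d) (r : Fin (F.P K).d → Fin (F.P K).L),
      ‖((Wcx (F.P K).L (avgIter (F.P K).L (pull (bgUnits F K U₀) (basePt F n K)) j) q κ (boxVec (F.P K).L r) : (Matrix (Fin 2) (Fin 2) ℂ)ˣ) : Matrix (Fin 2) (Fin 2) ℂ) - 1‖ ≤ 1 / 8)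
    (hφZ : ∀ j, j < K - n → ∀ (q : LSite (F.P K).d) (κ : Fin (F.P K).d) (r : Fin (F.P K).d → Fin (F.P K).L),
      ‖((Wcx (F.P K).L (avgIter (F.P K).L (pull (fun b => expUnit (Complex.I * z b)) (basePt F n K)) j) q κ (boxVec (F.P K).L r) : ℂˣ) : ℂ) - 1‖ ≤ 1 / 8)
    (hw : ∀ j, j < K - n → ∀ (w : LSite (F.P K).d) (r : Fin (F.P K).d → Fin (F.P K).L),
      ‖((((wrec (F.P K).L 1 (pull (fun b => expUnit (Complex.I * z b)) (basePt F n K)) j (((F.P K).L : ℤ) • w))⁻¹ *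
          (hol (avgIter (F.P K).L (pull (fun b => expUnit (Complex.I * z b)) (basePt F n K)) j) (((F.P K).L : ℤ) • w) (treeWord (boxVec (F.P K).L r)) *
            wrec (F.P K).L 1 (pull (fun b => expUnit (Complex.I * z b)) (basePt F n K)) j (((F.P K).L : ℤ) • w + boxVec (F.P K).L r)) : ℂˣ)) : ℂ) - 1‖ < 1)
    (y : Site (F.P n) 0) :
    frameTw F n K h U₀ (fun b => (Complex.I * z b) • (1 : Matrix (Fin 2) (Fin 2) ℂ)) y =
      Units.map ((algebraMap ℂ (Matrix (Fin 2) (Fin 2) ℂ) : ℂ →+* Matrix (Fin 2) (Fin 2) ℂ) : ℂ →* Matrix (Fin 2) (Fin 2) ℂ)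
        (wrec (F.P K).L 1 (pull (fun b => expUnit (Complex.I * z b)) (basePt F n K)) (K - n) (coordT3 F n K h y)) := by
  rw [frameTw_def, expUnit_smul_one_eq, pull_unitsMap]
  exact wrec_centralMul_self (F.P K).L _ _ (K - n) hUZ hφZ hw _

/-- ★★ **THE TWISTED DOUBLE-BAR VARIABLE OF A CENTRAL PERTURBATION IS A CENTRAL UNIT THAT DOES NOT SEE THE BACKGROUND**:
`dbarTw U₀ ((iz)·1) c = ιˣ( v(ĉ₋)⁻¹ · Ū^{(k)}(e^{iz})(ĉ) · v(ĉ₊) )`, `v := wrec L 1 φ♯ k ∘ coordT3`, `Ū^{(k)} = emlIterU k` the plain torus tower — the frames by `frameTw_central`, the descent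
`D̄(e^{A}U₀)(c) = ι(Ū^{(k)}(e^{iz})(ĉ))·Ū₀^{(k)}(ĉ)` by §1, and `Ū₀^{(k)}(ĉ)` cancels against `D̄(U₀)(c)⁻¹` after commuting past the central frame.  Windows displayed: the `ℤ³` ones of
`frameTw_central` and the torus loop variables of `Ū₀♭ʲ`, `Ūʲ(e^{iz})`, `j < K − n`. [cite: Balaban1985Averaging, (89)–(92) p.31; Balaban1987RG1, (0.4)+(0.11) p.253] -/
theorem dbarTw_central (U₀ : GaugeField (F.P K) 0 (Matrix.specialUnitaryGroup (Fin 2) ℂ)) (z : PBond (F.P K) 0 → ℂ)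
    (hUZ : ∀ j, j < K - n → ∀ (q : LSite (F.P K).d) (κ : Fin (F.P K).d) (r : Fin (F.P K).d → Fin (F.P K).L),
      ‖((Wcx (F.P K).L (avgIter (F.P K).L (pull (bgUnits F K U₀) (basePt F n K)) j) q κ (boxVec (F.P K).L r) : (Matrix (Fin 2) (Fin 2) ℂ)ˣ) : Matrix (Fin 2) (Fin 2) ℂ) - 1‖ ≤ 1 / 8)
    (hφZ : ∀ j, j < K - n → ∀ (q : LSite (F.P K).d) (κ : Fin (F.P K).d) (r : Fin (F.P K).d → Fin (F.P K).L),
      ‖((Wcx (F.P K).L (avgIter (F.P K).L (pull (fun b => expUnit (Complex.I * z b)) (basePt F n K)) j) q κ (boxVec (F.P K).L r) : ℂˣ) : ℂ) - 1‖ ≤ 1 / 8)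
    (hw : ∀ j, j < K - n → ∀ (w : LSite (F.P K).d) (r : Fin (F.P K).d → Fin (F.P K).L),
      ‖((((wrec (F.P K).L 1 (pull (fun b => expUnit (Complex.I * z b)) (basePt F n K)) j (((F.P K).L : ℤ) • w))⁻¹ *
          (hol (avgIter (F.P K).L (pull (fun b => expUnit (Complex.I * z b)) (basePt F n K)) j) (((F.P K).L : ℤ) • w) (treeWord (boxVec (F.P K).L r)) *
            wrec (F.P K).L 1 (pull (fun b => expUnit (Complex.I * z b)) (basePt F n K)) j (((F.P K).L : ℤ) • w + boxVec (F.P K).L r)) : ℂˣ)) : ℂ) - 1‖ < 1)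
    (hUT : ∀ j, j < K - n → ∀ (c : PBond (F.P K) (j + 1)) (i : Idx (F.P K)),
      ‖((loopHolU (emlIterU j (bgUnits F K U₀)) c i : (Matrix (Fin 2) (Fin 2) ℂ)ˣ) : Matrix (Fin 2) (Fin 2) ℂ) - 1‖ ≤ 1 / 8)
    (hφT : ∀ j, j < K - n → ∀ (c : PBond (F.P K) (j + 1)) (i : Idx (F.P K)), ‖((loopHolU (emlIterU j (fun b => expUnit (Complex.I * z b))) c i : ℂˣ) : ℂ) - 1‖ ≤ 1 / 8)
    (c : PBond (F.P n) 0) :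
    dbarTw F n K h U₀ (fun b => (Complex.I * z b) • (1 : Matrix (Fin 2) (Fin 2) ℂ)) c =
      Units.map ((algebraMap ℂ (Matrix (Fin 2) (Fin 2) ℂ) : ℂ →+* Matrix (Fin 2) (Fin 2) ℂ) : ℂ →* Matrix (Fin 2) (Fin 2) ℂ)
        ((wrec (F.P K).L 1 (pull (fun b => expUnit (Complex.I * z b)) (basePt F n K)) (K - n) (coordT3 F n K h c.src))⁻¹ *
          emlIterU (K - n) (fun b => expUnit (Complex.I * z b)) (bondShift (sites_eq F n K h) c) *
            wrec (F.P K).L 1 (pull (fun b => expUnit (Complex.I * z b)) (basePt F n K)) (K - n) (coordT3 F n K h c.tgt)) := by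
  rw [dbarTw_def, frameTw_central F h U₀ z hUZ hφZ hw, frameTw_central F h U₀ z hUZ hφZ hw, descendToGL_apply_eq_emlIterU, descendToGL_apply_eq_emlIterU, expUnit_smul_one_mul,
    emlIterU_centralMul _ _ (K - n) hUT hφT, map_mul, map_mul, map_inv]
  set ι := ((algebraMap ℂ (Matrix (Fin 2) (Fin 2) ℂ) : ℂ →+* Matrix (Fin 2) (Fin 2) ℂ) : ℂ →* Matrix (Fin 2) (Fin 2) ℂ) with hι
  set E := emlIterU (K - n) (bgUnits F K U₀) (bondShift (sites_eq F n K h) c) with hE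
  have hc := (commute_unitsMap_algebraMap (𝔸 := Matrix (Fin 2) (Fin 2) ℂ)
    (wrec (F.P K).L 1 (pull (fun b => expUnit (Complex.I * z b)) (basePt F n K)) (K - n) (coordT3 F n K h c.tgt)) E).eq
  rw [← hι] at hc
  calc (Units.map ι (wrec (F.P K).L 1 (pull (fun b => expUnit (Complex.I * z b)) (basePt F n K)) (K - n) (coordT3 F n K h c.src)))⁻¹ *
        (Units.map ι (emlIterU (K - n) (fun b => expUnit (Complex.I * z b)) (bondShift (sites_eq F n K h) c)) * E) *
        Units.map ι (wrec (F.P K).L 1 (pull (fun b => expUnit (Complex.I * z b)) (basePt F n K)) (K - n) (coordT3 F n K h c.tgt)) * E⁻¹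
      = (Units.map ι (wrec (F.P K).L 1 (pull (fun b => expUnit (Complex.I * z b)) (basePt F n K)) (K - n) (coordT3 F n K h c.src)))⁻¹ *
        Units.map ι (emlIterU (K - n) (fun b => expUnit (Complex.I * z b)) (bondShift (sites_eq F n K h) c)) *
        (E * Units.map ι (wrec (F.P K).L 1 (pull (fun b => expUnit (Complex.I * z b)) (basePt F n K)) (K - n) (coordT3 F n K h c.tgt))) * E⁻¹ := by
          simp only [mul_assoc]
    _ = (Units.map ι (wrec (F.P K).L 1 (pull (fun b => expUnit (Complex.I * z b)) (basePt F n K)) (K - n) (coordT3 F n K h c.src)))⁻¹ *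
        Units.map ι (emlIterU (K - n) (fun b => expUnit (Complex.I * z b)) (bondShift (sites_eq F n K h) c)) *
        Units.map ι (wrec (F.P K).L 1 (pull (fun b => expUnit (Complex.I * z b)) (basePt F n K)) (K - n) (coordT3 F n K h c.tgt)) := by
          rw [← hc]; simp only [mul_assoc, mul_inv_cancel, mul_one]

/-- the same identity AT THE FLAT BACKGROUND `U₀ = 1` (its loop clauses are vacuous: `1̄ʲ = 1` on `ℤ³` and on the torus). [cite: Balaban1985Averaging, (89)–(92) p.31, (160) p.42] -/
theorem dbarTw_central_one (z : PBond (F.P K) 0 → ℂ)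
    (hφZ : ∀ j, j < K - n → ∀ (q : LSite (F.P K).d) (κ : Fin (F.P K).d) (r : Fin (F.P K).d → Fin (F.P K).L),
      ‖((Wcx (F.P K).L (avgIter (F.P K).L (pull (fun b => expUnit (Complex.I * z b)) (basePt F n K)) j) q κ (boxVec (F.P K).L r) : ℂˣ) : ℂ) - 1‖ ≤ 1 / 8)
    (hw : ∀ j, j < K - n → ∀ (w : LSite (F.P K).d) (r : Fin (F.P K).d → Fin (F.P K).L),
      ‖((((wrec (F.P K).L 1 (pull (fun b => expUnit (Complex.I * z b)) (basePt F n K)) j (((F.P K).L : ℤ) • w))⁻¹ *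
          (hol (avgIter (F.P K).L (pull (fun b => expUnit (Complex.I * z b)) (basePt F n K)) j) (((F.P K).L : ℤ) • w) (treeWord (boxVec (F.P K).L r)) *
            wrec (F.P K).L 1 (pull (fun b => expUnit (Complex.I * z b)) (basePt F n K)) j (((F.P K).L : ℤ) • w + boxVec (F.P K).L r)) : ℂˣ)) : ℂ) - 1‖ < 1)
    (hφT : ∀ j, j < K - n → ∀ (c : PBond (F.P K) (j + 1)) (i : Idx (F.P K)), ‖((loopHolU (emlIterU j (fun b => expUnit (Complex.I * z b))) c i : ℂˣ) : ℂ) - 1‖ ≤ 1 / 8)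
    (c : PBond (F.P n) 0) :
    dbarTw F n K h 1 (fun b => (Complex.I * z b) • (1 : Matrix (Fin 2) (Fin 2) ℂ)) c =
      Units.map ((algebraMap ℂ (Matrix (Fin 2) (Fin 2) ℂ) : ℂ →+* Matrix (Fin 2) (Fin 2) ℂ) : ℂ →* Matrix (Fin 2) (Fin 2) ℂ)
        ((wrec (F.P K).L 1 (pull (fun b => expUnit (Complex.I * z b)) (basePt F n K)) (K - n) (coordT3 F n K h c.src))⁻¹ *
          emlIterU (K - n) (fun b => expUnit (Complex.I * z b)) (bondShift (sites_eq F n K h) c) *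
            wrec (F.P K).L 1 (pull (fun b => expUnit (Complex.I * z b)) (basePt F n K)) (K - n) (coordT3 F n K h c.tgt)) := by
  refine dbarTw_central F h 1 z ?_ hφZ hw ?_ hφT c
  · intro j _ q κ r
    rw [pull_bgUnits_one, avgIter_one, Wcx_one, Units.val_one, sub_self, norm_zero]
    norm_num
  · intro j _ c i
    rw [bgUnits_one, emlIterU_one, loopHolU_const_one, Units.val_one, sub_self, norm_zero]
    norm_num

/-- ★★ **`U̿^{tw}_{U₀}((iz)·1) = U̿^{tw}_{1}((iz)·1)`** — on central perturbations the twisted double-bar variable of a background with small loop variables takes ITS VALUE AT `U₀ = 1`.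
[cite: Balaban1985Averaging, (89)–(92) p.31; Balaban1984PropagatorsI, (1.18) p.20] -/
theorem dbarTw_central_eq_dbarTw_one (U₀ : GaugeField (F.P K) 0 (Matrix.specialUnitaryGroup (Fin 2) ℂ)) (z : PBond (F.P K) 0 → ℂ)
    (hUZ : ∀ j, j < K - n → ∀ (q : LSite (F.P K).d) (κ : Fin (F.P K).d) (r : Fin (F.P K).d → Fin (F.P K).L),
      ‖((Wcx (F.P K).L (avgIter (F.P K).L (pull (bgUnits F K U₀) (basePt F n K)) j) q κ (boxVec (F.P K).L r) : (Matrix (Fin 2) (Fin 2) ℂ)ˣ) : Matrix (Fin 2) (Fin 2) ℂ) - 1‖ ≤ 1 / 8)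
    (hφZ : ∀ j, j < K - n → ∀ (q : LSite (F.P K).d) (κ : Fin (F.P K).d) (r : Fin (F.P K).d → Fin (F.P K).L),
      ‖((Wcx (F.P K).L (avgIter (F.P K).L (pull (fun b => expUnit (Complex.I * z b)) (basePt F n K)) j) q κ (boxVec (F.P K).L r) : ℂˣ) : ℂ) - 1‖ ≤ 1 / 8)
    (hw : ∀ j, j < K - n → ∀ (w : LSite (F.P K).d) (r : Fin (F.P K).d → Fin (F.P K).L),
      ‖((((wrec (F.P K).L 1 (pull (fun b => expUnit (Complex.I * z b)) (basePt F n K)) j (((F.P K).L : ℤ) • w))⁻¹ *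
          (hol (avgIter (F.P K).L (pull (fun b => expUnit (Complex.I * z b)) (basePt F n K)) j) (((F.P K).L : ℤ) • w) (treeWord (boxVec (F.P K).L r)) *
            wrec (F.P K).L 1 (pull (fun b => expUnit (Complex.I * z b)) (basePt F n K)) j (((F.P K).L : ℤ) • w + boxVec (F.P K).L r)) : ℂˣ)) : ℂ) - 1‖ < 1)
    (hUT : ∀ j, j < K - n → ∀ (c : PBond (F.P K) (j + 1)) (i : Idx (F.P K)),
      ‖((loopHolU (emlIterU j (bgUnits F K U₀)) c i : (Matrix (Fin 2) (Fin 2) ℂ)ˣ) : Matrix (Fin 2) (Fin 2) ℂ) - 1‖ ≤ 1 / 8)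
    (hφT : ∀ j, j < K - n → ∀ (c : PBond (F.P K) (j + 1)) (i : Idx (F.P K)), ‖((loopHolU (emlIterU j (fun b => expUnit (Complex.I * z b))) c i : ℂˣ) : ℂ) - 1‖ ≤ 1 / 8)
    (c : PBond (F.P n) 0) :
    dbarTw F n K h U₀ (fun b => (Complex.I * z b) • (1 : Matrix (Fin 2) (Fin 2) ℂ)) c = dbarTw F n K h 1 (fun b => (Complex.I * z b) • (1 : Matrix (Fin 2) (Fin 2) ℂ)) c := by
  rw [dbarTw_central F h U₀ z hUZ hφZ hw hUT hφT c, dbarTw_central_one F h z hφZ hw hφT c]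

/-- ★★ **`log U̿^{tw}_{U₀}((iz)·1) = log U̿^{tw}_{1}((iz)·1)`** — the twisted log-chart of a central perturbation is background-independent (under the displayed windows).
[cite: Balaban1985RegularSpaces, (1.31) p.82; Balaban1985BackgroundPropagators, (3.13) p.393] -/
theorem logChartTw_central_eq_logChartTw_one (U₀ : GaugeField (F.P K) 0 (Matrix.specialUnitaryGroup (Fin 2) ℂ)) (z : PBond (F.P K) 0 → ℂ)
    (hUZ : ∀ j, j < K - n → ∀ (q : LSite (F.P K).d) (κ : Fin (F.P K).d) (r : Fin (F.P K).d → Fin (F.P K).L),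
      ‖((Wcx (F.P K).L (avgIter (F.P K).L (pull (bgUnits F K U₀) (basePt F n K)) j) q κ (boxVec (F.P K).L r) : (Matrix (Fin 2) (Fin 2) ℂ)ˣ) : Matrix (Fin 2) (Fin 2) ℂ) - 1‖ ≤ 1 / 8)
    (hφZ : ∀ j, j < K - n → ∀ (q : LSite (F.P K).d) (κ : Fin (F.P K).d) (r : Fin (F.P K).d → Fin (F.P K).L),
      ‖((Wcx (F.P K).L (avgIter (F.P K).L (pull (fun b => expUnit (Complex.I * z b)) (basePt F n K)) j) q κ (boxVec (F.P K).L r) : ℂˣ) : ℂ) - 1‖ ≤ 1 / 8)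
    (hw : ∀ j, j < K - n → ∀ (w : LSite (F.P K).d) (r : Fin (F.P K).d → Fin (F.P K).L),
      ‖((((wrec (F.P K).L 1 (pull (fun b => expUnit (Complex.I * z b)) (basePt F n K)) j (((F.P K).L : ℤ) • w))⁻¹ *
          (hol (avgIter (F.P K).L (pull (fun b => expUnit (Complex.I * z b)) (basePt F n K)) j) (((F.P K).L : ℤ) • w) (treeWord (boxVec (F.P K).L r)) *
            wrec (F.P K).L 1 (pull (fun b => expUnit (Complex.I * z b)) (basePt F n K)) j (((F.P K).L : ℤ) • w + boxVec (F.P K).L r)) : ℂˣ)) : ℂ) - 1‖ < 1)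
    (hUT : ∀ j, j < K - n → ∀ (c : PBond (F.P K) (j + 1)) (i : Idx (F.P K)),
      ‖((loopHolU (emlIterU j (bgUnits F K U₀)) c i : (Matrix (Fin 2) (Fin 2) ℂ)ˣ) : Matrix (Fin 2) (Fin 2) ℂ) - 1‖ ≤ 1 / 8)
    (hφT : ∀ j, j < K - n → ∀ (c : PBond (F.P K) (j + 1)) (i : Idx (F.P K)), ‖((loopHolU (emlIterU j (fun b => expUnit (Complex.I * z b))) c i : ℂˣ) : ℂ) - 1‖ ≤ 1 / 8) :
    logChartTw F n K h U₀ (fun b => (Complex.I * z b) • (1 : Matrix (Fin 2) (Fin 2) ℂ)) = logChartTw F n K h 1 (fun b => (Complex.I * z b) • (1 : Matrix (Fin 2) (Fin 2) ℂ)) := by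
  funext c
  rw [logChartTw_apply, logChartTw_apply, dbarTw_central_eq_dbarTw_one F h U₀ z hUZ hφZ hw hUT hφT c]

/-! ## §3 Calculus: two charts that agree along a real line near `0` have the same directional derivative -/

/-- ★ **`Q(U₀)V = Q(U₁)V` FROM AGREEMENT ALONG THE LINE**: if both twisted log-charts are differentiable at `0` and `log U̿^{tw}_{U₀}(t•V) = log U̿^{tw}_{U₁}(t•V)` for REAL `t` near `0`, then
`QTw U₀ V = QTw U₁ V` (the ℂ-Fréchet derivatives read along the real line; uniqueness of the real derivative). [cite: Balaban1985BackgroundPropagators, (3.14)-(3.15) p.393] -/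
theorem QTw_apply_eq_of_eventuallyEq_line (U₀ U₁ : GaugeField (F.P K) 0 (Matrix.specialUnitaryGroup (Fin 2) ℂ)) (V : PBond (F.P K) 0 → Matrix (Fin 2) (Fin 2) ℂ)
    (hd₀ : DifferentiableAt ℂ (logChartTw F n K h U₀) 0) (hd₁ : DifferentiableAt ℂ (logChartTw F n K h U₁) 0)
    (hline : ∀ᶠ t : ℝ in 𝓝 0, logChartTw F n K h U₀ (t • V) = logChartTw F n K h U₁ (t • V)) :
    QTw F n K h U₀ V = QTw F n K h U₁ V := by
  -- the real line through `0` in direction `V`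
  have hl : HasDerivAt (fun t : ℝ => t • V) V 0 := by
    simpa using (hasDerivAt_id (0 : ℝ)).smul_const V
  have h0 : (0 : PBond (F.P K) 0 → Matrix (Fin 2) (Fin 2) ℂ) = (0 : ℝ) • V := by rw [zero_smul]
  have h₀ := ((QTw_def (F := F) (n := n) (K := K) (h := h) U₀ ▸ hd₀.hasFDerivAt).restrictScalars ℝ).comp_hasDerivAt_of_eq (0 : ℝ) hl h0
  have h₁ := ((QTw_def (F := F) (n := n) (K := K) (h := h) U₁ ▸ hd₁.hasFDerivAt).restrictScalars ℝ).comp_hasDerivAt_of_eq (0 : ℝ) hl h0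
  have hline' : (logChartTw F n K h U₀ ∘ fun t : ℝ => t • V) =ᶠ[𝓝 0] (logChartTw F n K h U₁ ∘ fun t : ℝ => t • V) := by
    filter_upwards [hline] with t ht
    exact ht
  have h₀' := h₁.congr_of_eventuallyEq hline'
  have hu := h₀.unique h₀'
  simpa using hu

/-! ## §4 `Q(U₀)` on the centre is its flat value -/

/-- ★★★ **`QTw U₀ ((i r)·1) = QTw 1 ((i r)·1)` FOR A REAL BOND FIELD `r`**, given: both charts differentiable at `0` (`hd`, `hd₁`), the background loop windows on `ℤ³` and on the torus
(`hUZ`, `hUT` — at a printed-regular background: lit Prop. 2 ∕ ✓`loopHolU_emlIterU_bgUnits_le_eighth_of_regPr`), and the DISPLAYED `∃ δ` clause: for real `|t| < δ` the scalar field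
`e^{itr}` has `1∕8`-small loop variables at every level on `ℤ³` and on the torus and flat frame quotients within `1` (a UNITARY scalar field: lit Prop. 2 + `B8Prop7AdmittedFamily` §3 at `𝔸 = ℂ`;
the sibling file).  Along the line, `log U̿^{tw}_{U₀} = log U̿^{tw}_{1}` by §2; then §3. [cite: Balaban1985BackgroundPropagators, (3.14)-(3.15) p.393; Balaban1984PropagatorsI, (1.18) p.20; Balaban1985Averaging, (85)-(92) p.31] -/
theorem QTw_smulI_one_eq_QTw_one (U₀ : GaugeField (F.P K) 0 (Matrix.specialUnitaryGroup (Fin 2) ℂ)) (r : PBond (F.P K) 0 → ℝ)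
    (hd : DifferentiableAt ℂ (logChartTw F n K h U₀) 0) (hd₁ : DifferentiableAt ℂ (logChartTw F n K h 1) 0)
    (hUZ : ∀ j, j < K - n → ∀ (q : LSite (F.P K).d) (κ : Fin (F.P K).d) (rr : Fin (F.P K).d → Fin (F.P K).L),
      ‖((Wcx (F.P K).L (avgIter (F.P K).L (pull (bgUnits F K U₀) (basePt F n K)) j) q κ (boxVec (F.P K).L rr) : (Matrix (Fin 2) (Fin 2) ℂ)ˣ) : Matrix (Fin 2) (Fin 2) ℂ) - 1‖ ≤ 1 / 8)
    (hUT : ∀ j, j < K - n → ∀ (c : PBond (F.P K) (j + 1)) (i : Idx (F.P K)),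
      ‖((loopHolU (emlIterU j (bgUnits F K U₀)) c i : (Matrix (Fin 2) (Fin 2) ℂ)ˣ) : Matrix (Fin 2) (Fin 2) ℂ) - 1‖ ≤ 1 / 8)
    (hδ : ∃ δ : ℝ, 0 < δ ∧ ∀ t : ℝ, |t| < δ →
      (∀ j, j < K - n → ∀ (q : LSite (F.P K).d) (κ : Fin (F.P K).d) (rr : Fin (F.P K).d → Fin (F.P K).L),
        ‖((Wcx (F.P K).L (avgIter (F.P K).L (pull (fun b => expUnit (Complex.I * (((t * r b : ℝ)) : ℂ))) (basePt F n K)) j) q κ (boxVec (F.P K).L rr) : ℂˣ) : ℂ) - 1‖ ≤ 1 / 8) ∧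
      (∀ j, j < K - n → ∀ (w : LSite (F.P K).d) (rr : Fin (F.P K).d → Fin (F.P K).L),
        ‖((((wrec (F.P K).L 1 (pull (fun b => expUnit (Complex.I * (((t * r b : ℝ)) : ℂ))) (basePt F n K)) j (((F.P K).L : ℤ) • w))⁻¹ *
            (hol (avgIter (F.P K).L (pull (fun b => expUnit (Complex.I * (((t * r b : ℝ)) : ℂ))) (basePt F n K)) j) (((F.P K).L : ℤ) • w) (treeWord (boxVec (F.P K).L rr)) *
              wrec (F.P K).L 1 (pull (fun b => expUnit (Complex.I * (((t * r b : ℝ)) : ℂ))) (basePt F n K)) j (((F.P K).L : ℤ) • w + boxVec (F.P K).L rr)) : ℂˣ)) : ℂ) - 1‖ < 1) ∧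
      (∀ j, j < K - n → ∀ (c : PBond (F.P K) (j + 1)) (i : Idx (F.P K)),
        ‖((loopHolU (emlIterU j (fun b => expUnit (Complex.I * (((t * r b : ℝ)) : ℂ)))) c i : ℂˣ) : ℂ) - 1‖ ≤ 1 / 8)) :
    QTw F n K h U₀ (fun b => (Complex.I * (r b : ℂ)) • (1 : Matrix (Fin 2) (Fin 2) ℂ)) = QTw F n K h 1 (fun b => (Complex.I * (r b : ℂ)) • (1 : Matrix (Fin 2) (Fin 2) ℂ)) := by
  obtain ⟨δ, hδ0, hδ⟩ := hδ
  refine QTw_apply_eq_of_eventuallyEq_line F h U₀ 1 _ hd hd₁ ?_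
  have hball : Metric.ball (0 : ℝ) δ ∈ 𝓝 (0 : ℝ) := Metric.ball_mem_nhds 0 hδ0
  filter_upwards [hball] with t ht
  rw [Metric.mem_ball, dist_zero_right, Real.norm_eq_abs] at ht
  obtain ⟨hφZ, hw, hφT⟩ := hδ t ht
  have hline : (t • fun b => (Complex.I * (r b : ℂ)) • (1 : Matrix (Fin 2) (Fin 2) ℂ)) = fun b => (Complex.I * (((t * r b : ℝ)) : ℂ)) • (1 : Matrix (Fin 2) (Fin 2) ℂ) := by
    funext b
    rw [Pi.smul_apply, ← Complex.coe_smul, smul_smul, Complex.ofReal_mul]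
    ring_nf
  rw [hline]
  exact logChartTw_central_eq_logChartTw_one F h U₀ _ hUZ hφZ hw hUT hφT

/-- ★★★ **ℂ-LINEARITY: FROM THE IMAGINARY DIRECTIONS TO THE WHOLE CENTRE** — if `QTw U₀ ((i r)·1) = QTw 1 ((i r)·1)` for every REAL `r`, then `QTw U₀ (c·1) = QTw 1 (c·1)` for every complex
`c` (`c·1 = (−i)·((i·Re c)·1) + (i·Im c)·1` and `QTw` is ℂ-linear). [cite: Balaban1985BackgroundPropagators, (3.14)-(3.15) p.393] -/
theorem QTw_smul_one_eq_QTw_one_of_imaginary (U₀ : GaugeField (F.P K) 0 (Matrix.specialUnitaryGroup (Fin 2) ℂ))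
    (hI : ∀ r : PBond (F.P K) 0 → ℝ,
      QTw F n K h U₀ (fun b => (Complex.I * (r b : ℂ)) • (1 : Matrix (Fin 2) (Fin 2) ℂ)) = QTw F n K h 1 (fun b => (Complex.I * (r b : ℂ)) • (1 : Matrix (Fin 2) (Fin 2) ℂ)))
    (c : PBond (F.P K) 0 → ℂ) :
    QTw F n K h U₀ (fun b => c b • (1 : Matrix (Fin 2) (Fin 2) ℂ)) = QTw F n K h 1 (fun b => c b • (1 : Matrix (Fin 2) (Fin 2) ℂ)) := by
  have hsplit : (fun b => c b • (1 : Matrix (Fin 2) (Fin 2) ℂ)) =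
      (-Complex.I) • (fun b => (Complex.I * ((c b).re : ℂ)) • (1 : Matrix (Fin 2) (Fin 2) ℂ)) + (fun b => (Complex.I * ((c b).im : ℂ)) • (1 : Matrix (Fin 2) (Fin 2) ℂ)) := by
    funext b
    simp only [Pi.add_apply, Pi.smul_apply, smul_smul, ← add_smul]
    congr 1
    rw [← Complex.re_add_im (c b)]
    simp only [Complex.add_re, Complex.add_im, Complex.ofReal_re, Complex.ofReal_im, Complex.mul_re, Complex.mul_im, Complex.I_re, Complex.I_im]
    ring_nf
    rw [Complex.I_sq]
    ring
  rw [hsplit, map_add, map_add, map_smul, map_smul, hI (fun b => (c b).re), hI (fun b => (c b).im)]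

end T3

end Summit.QuantumFields.YangMills.Theorems.Prop7QTwCentralSector

end
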